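import Summits.Parity.GeneralizedHardyLittlewood.Theses.LeeYangFibres
import Summits.Parity.GeneralizedHardyLittlewood.Theorems.LeeYangFibresPrimeCellsRelativeCellsArithUp
import Summits.Parity.GeneralizedHardyLittlewood.Theorems.LeeYangFibresPrimeCellsRelativeUpTransfer
import Summits.Parity.GeneralizedHardyLittlewood.Theorems.LeeYangFibresPrimeCellsRelativeDimOneOne
import Summits.Parity.GeneralizedHardyLittlewood.Theorems.LeeYangFibresRelativeDimOne
import Summits.Parity.GeneralizedHardyLittlewood.Theorems.LeeYangFibresPrimeCellsRelativeLocator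
import HarnessLib

/-!
# Crux `PrimeCellsRelative` (stmt-Parity-14112, route `LeeYangFibres`) — line `Sketch` (locator composition), skeleton
# 3/4 stubs LANDED and imported, 1 sorry = the open problem

Lead `prover-line-stmt-Parity-14112-0` (cycle 1), continued by `prover-line-stmt-Parity-14112-1` (cycle 2), `…-c1-0`, `…-c2-0` (cycle 3:
tightness certificate `stub_iff_primeCellsRelative` below — the one open stub is EQUIVALENT to the crux, so the line cannot
die short of the crux being false, and the crux is implied by the audited Statement). The crux is the counting form of Dickson–Hardy–Littlewood for rough
prime cells with Green–Tao's Conj. 1.4 error shape; it is open-problem grade: it implies the twin prime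
conjecture (`primeCellsRelative_implies_twinPrimeConjecture`, LANDED in `…Locator`) and is implied by the
sub-problem Statement (`primeCellsRelative_of_generalizedHardyLittlewood`, LANDED). The line does not claim to
close it: it isolates the whole conjectural content in ONE registered stub which is a slice of an existing item,
and proves everything else.

Registered stubs:
* `stub_cellsArithUp` — LANDED (`Theorems/LeeYangFibresPrimeCellsRelativeCellsArithUp`, p87154);
* `stub_upTransfer` — LANDED (`Theorems/LeeYangFibresPrimeCellsRelativeUpTransfer`, p88597): `RelativeDimOne` at
  `t` forms ⟹ `PrimeCellsRelative` at `t` forms;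
* `stub_dimOne_one` — LANDED (`Theorems/LeeYangFibresPrimeCellsRelativeDimOneOne`, p87659): the `t = 1` case of
  `DimOne`, unconditional (Green–Tao 2010 Thm 4.5 at level `s = 1`, proved in the tree);
* `stub_relativeDimOne_two_le` — OPEN (held by the lead): `RelativeDimOne` (stmt-Parity-14113) for `t ≥ 2`
  forms = Hardy–Littlewood prime tuples to relative accuracy `o(1)`; implied by `DimOne` (stmt-Parity-0819).
Landed consequences (`…Locator`): `PrimeCellsRelative ↔ RelativeDimOne` (14112 ≡ 14113), `DimOne → PCR`,
`GeneralizedHardyLittlewood → PCR`, the `t = 1` slice `primeCellsRelative_at_one` (a THEOREM),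
`PCR ⟸ RelativeDimOne(t ≥ 2)`, `PCR → TwinPrimeConjecture`.
Landed in cycle 2 (`…Hardness`, p96058, continuation lead `-1`): the in-route closure path
`CellParityLaw → FibreHyperbolicity → PCR` (items 14114 + 14111 CLOSED; so the crux closes by pure logic
the moment 14108 ∧ 14109, or 14113, or 0819 close), `PCR → UpperRelativeDimOne`, `PCR → UniformCharPNT`
(GRH-lite hardness, via the 14113 line's Gallagher-backwards certificates) and the Siegel guard
`MatomakiMerikoski2023_pairCorrelation → PCR → ¬UnboundedSiegelZeros`.
-/

noncomputable section

namespace Summit.Parity.GeneralizedHardyLittlewood.Cruxes.PrimeCellsRelative.Sketch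

open scoped BigOperators Topology Classical
open Filter Finset Literature.NumberTheory.Sieve
open Summit.Parity.GeneralizedHardyLittlewood.Theses.LeeYangFibres

/-! ## The one open stub -/

/-- **stub (OPEN — held by the lead; the conjectural content of the crux).** `RelativeDimOne`
(stmt-Parity-14113) for systems of `t ≥ 2` forms: the Λ-weighted Dickson–Hardy–Littlewood asymptotic at `d = 1`
with Green–Tao's relative + absolute error, uniform over non-degenerate systems of size `≤ L` and convex
`K ⊆ [-N, N]`. Contains the twin prime and Sophie Germain asymptotics to relative accuracy `o(1)`; implied by the
shared target `DimOne` (stmt-Parity-0819) via the PROVED `relativeDimOne_of_dimOne`; Siegel-sensitive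
(MatomakiMerikoski2023 Thm 1.3). [cite: GreenTao2010, Conj. 1.2 and Conj. 1.4] -/
theorem stub_relativeDimOne_two_le (t : ℕ) (ht : 2 ≤ t) :
    ∀ L : ℕ, ∀ ε : ℝ, 0 < ε → ∃ N₀ : ℕ, ∀ N : ℕ, N₀ ≤ N → ∀ Ψ : Fin t → Literature.NumberTheory.Sieve.AffLinForm 1, Literature.NumberTheory.Sieve.IsNondegenerateSystem Ψ → Literature.NumberTheory.Sieve.affLinSize Ψ N ≤ L → ∀ K : Set (Fin 1 → ℝ), Convex ℝ K → K ⊆ Literature.NumberTheory.Sieve.realBox 1 N → |Literature.NumberTheory.Sieve.vonMangoldtSum Ψ K N - Literature.NumberTheory.Sieve.archFactor Ψ K * Literature.NumberTheory.Sieve.singularProduct Ψ| ≤ ε * (Literature.NumberTheory.Sieve.archFactor Ψ K * Literature.NumberTheory.Sieve.singularProduct Ψ + N) := by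
  sorry

/-! ## Composition -/

/-- Absolute ⟹ relative error at fixed `t` — skeleton-local copy of the LANDED
`relative_of_absolute` (`Theorems/LeeYangFibresPrimeCellsRelativeLocator`, p89136), kept here under a distinct
name only so that this workfile elaborates on farm snapshots that predate that module. -/
theorem relativeOfAbsoluteSkel (t : ℕ)
    (hD : ∀ L : ℕ, ∀ ε : ℝ, 0 < ε → ∃ N₀ : ℕ, ∀ N : ℕ, N₀ ≤ N → ∀ Ψ : Fin t → Literature.NumberTheory.Sieve.AffLinForm 1, Literature.NumberTheory.Sieve.IsNondegenerateSystem Ψ → Literature.NumberTheory.Sieve.affLinSize Ψ N ≤ L → ∀ K : Set (Fin 1 → ℝ), Convex ℝ K → K ⊆ Literature.NumberTheory.Sieve.realBox 1 N → |Literature.NumberTheory.Sieve.vonMangoldtSum Ψ K N - Literature.NumberTheory.Sieve.archFactor Ψ K * Literature.NumberTheory.Sieve.singularProduct Ψ| ≤ ε * (N : ℝ)) :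
    ∀ L : ℕ, ∀ ε : ℝ, 0 < ε → ∃ N₀ : ℕ, ∀ N : ℕ, N₀ ≤ N → ∀ Ψ : Fin t → Literature.NumberTheory.Sieve.AffLinForm 1, Literature.NumberTheory.Sieve.IsNondegenerateSystem Ψ → Literature.NumberTheory.Sieve.affLinSize Ψ N ≤ L → ∀ K : Set (Fin 1 → ℝ), Convex ℝ K → K ⊆ Literature.NumberTheory.Sieve.realBox 1 N → |Literature.NumberTheory.Sieve.vonMangoldtSum Ψ K N - Literature.NumberTheory.Sieve.archFactor Ψ K * Literature.NumberTheory.Sieve.singularProduct Ψ| ≤ ε * (Literature.NumberTheory.Sieve.archFactor Ψ K * Literature.NumberTheory.Sieve.singularProduct Ψ + N) := by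
  intro L ε hε
  obtain ⟨N₀, hN₀⟩ := hD L (min ε 1 / 2) (by positivity)
  refine ⟨N₀, fun N hN Ψ hΨ hL K hK hKN => ?_⟩
  have hb := hN₀ N hN Ψ hΨ hL K hK hKN
  have hS := Theorems.LeeYangFibresRelativeDimOne.vonMangoldtSum_nonneg Ψ K N
  set S := vonMangoldtSum Ψ K N with hSdef
  set M := archFactor Ψ K * singularProduct Ψ with hMdef
  have hN0 : (0 : ℝ) ≤ N := Nat.cast_nonneg N
  have hε1 : min ε 1 / 2 ≤ ε / 2 := by
    have := min_le_left ε 1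
    linarith
  have hε2 : min ε 1 / 2 ≤ 1 / 2 := by
    have := min_le_right ε 1
    linarith
  have hab := abs_le.mp hb
  have hM : -(1 / 2 * (N : ℝ)) ≤ M := by
    have h1 : min ε 1 / 2 * (N : ℝ) ≤ 1 / 2 * N := mul_le_mul_of_nonneg_right hε2 hN0
    linarith [hab.1, hab.2]
  have hεM : -(ε / 2 * (N : ℝ)) ≤ ε * M := by
    have := mul_le_mul_of_nonneg_left hM hε.le
    linarith
  have h2 : min ε 1 / 2 * (N : ℝ) ≤ ε / 2 * N := mul_le_mul_of_nonneg_right hε1 hN0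
  calc |S - M| ≤ min ε 1 / 2 * (N : ℝ) := hb
    _ ≤ ε * (M + N) := by nlinarith

/-- **Composition of the line (pure logic over the landed stubs).** Slice the crux by the number of forms
`t`: at `t = 1` it is `stub_upTransfer 1` (LANDED) applied to `relativeOfAbsoluteSkel 1 stub_dimOne_one` (LANDED)
— the landed theorem `primeCellsRelative_at_one` of `…Locator`; at `t ≥ 2` it is `stub_upTransfer t` applied to
the open stub `stub_relativeDimOne_two_le t`. -/
theorem PrimeCellsRelative_of : PrimeCellsRelative := by
  intro t L ht ε hε
  rcases Nat.lt_or_ge t 2 with h2 | h2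
  · obtain rfl : t = 1 := by omega
    exact stub_upTransfer 1 le_rfl (relativeOfAbsoluteSkel 1 stub_dimOne_one) L ε hε
  · exact stub_upTransfer t ht (stub_relativeDimOne_two_le t h2) L ε hε

/-! ## Tightness of the skeleton (cycle 3, seat `c2-0`) -/

/-- **Tightness certificate: the one open stub is EQUIVALENT to the crux** (so the skeleton is lossless and
the line `Sketch` can only die together with the crux itself, which in turn is implied by the audited
Statement via `primeCellsRelative_of_generalizedHardyLittlewood`). Forward: the composition
`primeCellsRelative_of_relativeDimOne_two_le` (LANDED, `…Locator`, with the `t = 1` slice a theorem);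
backward: `PrimeCellsRelative → RelativeDimOne` (item stmt-Parity-14115, PROVED) restricted to `t ≥ 2`.
Hence `stub_relativeDimOne_two_le` ⟺ stmt-Parity-14112 ⟺ stmt-Parity-14113, kernel-checked.
[cite: GreenTao2010, Conj. 1.4 (sketch proof)] -/
theorem stub_iff_primeCellsRelative :
    (∀ t : ℕ, 2 ≤ t → ∀ L : ℕ, ∀ ε : ℝ, 0 < ε → ∃ N₀ : ℕ, ∀ N : ℕ, N₀ ≤ N → ∀ Ψ : Fin t → Literature.NumberTheory.Sieve.AffLinForm 1, Literature.NumberTheory.Sieve.IsNondegenerateSystem Ψ → Literature.NumberTheory.Sieve.affLinSize Ψ N ≤ L → ∀ K : Set (Fin 1 → ℝ), Convex ℝ K → K ⊆ Literature.NumberTheory.Sieve.realBox 1 N → |Literature.NumberTheory.Sieve.vonMangoldtSum Ψ K N - Literature.NumberTheory.Sieve.archFactor Ψ K * Literature.NumberTheory.Sieve.singularProduct Ψ| ≤ ε * (Literature.NumberTheory.Sieve.archFactor Ψ K * Literature.NumberTheory.Sieve.singularProduct Ψ + N)) ↔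
    PrimeCellsRelative := by
  refine ⟨primeCellsRelative_of_relativeDimOne_two_le, fun hP t ht L ε hε => ?_⟩
  exact (primeCellsRelative_iff_relativeDimOne.mp hP) t L (le_trans one_le_two ht) ε hε

/-- **Corollary: the open stub is exactly item stmt-Parity-14113 (`RelativeDimOne`)** — not merely its `t ≥ 2`
slice: the `t = 1` slice of `RelativeDimOne` is a theorem (`stub_dimOne_one` + `relative_of_absolute`). -/
theorem stub_iff_relativeDimOne :
    (∀ t : ℕ, 2 ≤ t → ∀ L : ℕ, ∀ ε : ℝ, 0 < ε → ∃ N₀ : ℕ, ∀ N : ℕ, N₀ ≤ N → ∀ Ψ : Fin t → Literature.NumberTheory.Sieve.AffLinForm 1, Literature.NumberTheory.Sieve.IsNondegenerateSystem Ψ → Literature.NumberTheory.Sieve.affLinSize Ψ N ≤ L → ∀ K : Set (Fin 1 → ℝ), Convex ℝ K → K ⊆ Literature.NumberTheory.Sieve.realBox 1 N → |Literature.NumberTheory.Sieve.vonMangoldtSum Ψ K N - Literature.NumberTheory.Sieve.archFactor Ψ K * Literature.NumberTheory.Sieve.singularProduct Ψ| ≤ ε * (Literature.NumberTheory.Sieve.archFactor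 Ψ K * Literature.NumberTheory.Sieve.singularProduct Ψ + N)) ↔
    RelativeDimOne :=
  stub_iff_primeCellsRelative.trans primeCellsRelative_iff_relativeDimOne

end Summit.Parity.GeneralizedHardyLittlewood.Cruxes.PrimeCellsRelative.Sketch

end
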